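import Literature.AlgebraicGeometry.Motives.VerticalSurfaceOverCurve
import Literature.AlgebraicGeometry.Motives.PlanesOfLineFamily
import HarnessLib

/-!
# Vertical surfaces of a line family over a two-dimensional base are sums of planes

The glue of `Motives/VerticalSurfaceOverCurve` (B3) with Stage 2 (`Motives/PlanesOfLineFamily`):
on a cubic hypersurface `X = V₊(F) ⊆ ℙᵈ⁺¹_k` (`k` algebraically closed, `d ≥ 14`), for an integral
proper base `T`, a point `b ∈ T` of dimension `1`, and a point `z ∈ X ×ₖ T` over `b` whose image in
`ℙᵈ⁺¹ ×ₖ T` is the fibre slice `σ_b` of the generic point of a `κ(b)`-LINE, the push-forward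
`pr₁₊ [z]` to `X` is rationally equivalent to an integral combination of PLANES of `X`
(`ProjFamily.exists_planes_of_vertical_over_curve`): lift `z` to the generic fibre of
`X ×ₖ Γ^ν → Γ^ν` (`Γ^ν` the normalization of `closure {b}`, a smooth proper curve), where it lies
over a `k(Γ^ν)`-line, and apply `ProjFamily.exists_planes_of_line`. Everything is proved.

## References

* [TianZong2014] Z. Tian, H. R. Zong, *One-cycles on rationally connected varieties*, Compositio
  Math. 150 (2014), proof of Prop. 7.2.
* [Mboro2018] R. Mboro, *Remarks on the CH₂ of cubic hypersurfaces*, arXiv:1701.04488, Cor. 2.9.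
-/

noncomputable section

open CategoryTheory CategoryTheory.Limits AlgebraicGeometry MonoidalCategory MvPolynomial
  TopologicalSpace Order

universe u

namespace Literature.AlgebraicGeometry.Motives

attribute [local instance] MvPolynomial.gradedAlgebra MvPolynomial.algebraMvPolynomial
  Literature.AlgebraicGeometry.Motives.ProjBaseChange.algebraBase
  UniversalHyperplaneSection.sectionsAlgebra ProjFamily.functionFieldAlgebra

namespace ProjFamily

open ProjBaseChangeRing ProjectiveSpaceCells

variable {k : Type u} [Field k]

/-- **Vertical surfaces over curves are sums of planes.** See the module docstring.
[cite: TianZong2014, Prop. 7.2 (proof)] [cite: Mboro2018, Cor. 2.9] -/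
theorem exists_planes_of_vertical_over_curve [IsAlgClosed k] {d : ℕ} (hd : 14 ≤ d)
    (T : SchemeOver k) [IsIntegral T.left] [IsProper T.hom]
    (X : SchemeOver k) (i : X ⟶ projectiveSpace (d + 1) k) [IsClosedImmersion i.left]
    {F : MvPolynomial (Fin (d + 1 + 1)) k} (hF3 : F.IsHomogeneous 3)
    (hrange : Set.range i.left.base =
      ProjectiveSpectrum.zeroLocus (homogeneousSubmodule (Fin (d + 1 + 1)) k) {F})
    {U : T.left.Opens} (hU : IsAffineOpen U) (b : U) (hb1 : height (b : T.left) = 1)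
    [Algebra Γ(T.left, U) (IsLocalRing.ResidueField (T.left.presheaf.stalk (b : T.left)))]
    [IsScalarTower Γ(T.left, U) (T.left.presheaf.stalk (b : T.left))
      (IsLocalRing.ResidueField (T.left.presheaf.stalk (b : T.left)))]
    {Lb : Fin (d + 1 - 1) → MvPolynomial (Fin (d + 1 + 1))
      (IsLocalRing.ResidueField (T.left.presheaf.stalk (b : T.left)))}
    (hLb : LinearIndependent (IsLocalRing.ResidueField (T.left.presheaf.stalk (b : T.left))) Lb)
    (hLbhom : ∀ l, (Lb l).IsHomogeneous 1)
    [QuasiCompact (CartesianMonoidalCategory.fst X T).left]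
    {z : ↥(X ⊗ T).left}
    (hz : (i ▷ T).left.base z =
      (Proj.map (mapGraded Γ(T.left, U)
        (IsLocalRing.ResidueField (T.left.presheaf.stalk (b : T.left))) (Fin (d + 1 + 1)))
        (irrelevant_le_map Γ(T.left, U)
          (IsLocalRing.ResidueField (T.left.presheaf.stalk (b : T.left))) (Fin (d + 1 + 1))) ≫
        openPiece (d + 1) T hU).base (linearSubspacePoint Lb hLb hLbhom (Nat.sub_le (d + 1) 1))) :
    ∃ (s : Finset ↥X.left) (w : ↥X.left → ℤ), (∀ y ∈ s, IsLinearSubspacePoint 2 (d + 1) i y) ∧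
      IsRationallyEquivalent
        (AlgebraicCycle.map (CartesianMonoidalCategory.fst X T).left height height (primeCycle z))
        (∑ y ∈ s, w y • primeCycle y) 2 := by
  classical
  set C := curveB T (b : T.left) with hC
  -- the curve `Γ^ν`: smooth, proper, `trdeg 1`
  haveI : IsProper C.hom := isProper_curveB T (b : T.left)
  haveI : IsProper (projectiveSpace (d + 1) k).hom := isProper_projectiveSpace (d + 1) k
  haveI : IsProper X.hom := by rw [← Over.w i]; infer_instance
  haveI : QuasiCompact (CartesianMonoidalCategory.fst X C).left :=
    inferInstanceAs (QuasiCompact (pullback.fst X.hom C.hom))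
  have hB1 : height (genericPoint C.left) = 1 := height_genericPoint_curveB hb1
  have hpid : ∀ c : C.left, IsClosed ({c} : Set C.left) → IsPrincipalIdealRing (C.left.presheaf.stalk c) :=
    fun c _ => isPrincipalIdealRing_stalk_curveB hb1 c
  have htr : Algebra.trdeg k C.left.functionField = 1 := trdeg_curveB hb1
  -- `z` lies over `b`
  have hzb : (CartesianMonoidalCategory.snd X T).left.base z = (b : T.left) := by
    have h1 : (CartesianMonoidalCategory.snd X T).left.base z =
        (CartesianMonoidalCategory.snd (projectiveSpace (d + 1) k) T).left.base ((i ▷ T).left.base z) := by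
      change _ = ((i ▷ T).left ≫ (CartesianMonoidalCategory.snd (projectiveSpace (d + 1) k) T).left).base z
      rw [whiskerRight_left_snd]
    rw [h1, hz]
    have hmem : (Proj.map (mapGraded Γ(T.left, U)
        (IsLocalRing.ResidueField (T.left.presheaf.stalk (b : T.left))) (Fin (d + 1 + 1)))
        (irrelevant_le_map Γ(T.left, U)
          (IsLocalRing.ResidueField (T.left.presheaf.stalk (b : T.left))) (Fin (d + 1 + 1))) ≫
        openPiece (d + 1) T hU).base (linearSubspacePoint Lb hLb hLbhom (Nat.sub_le (d + 1) 1)) ∈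
        (CartesianMonoidalCategory.snd (projectiveSpace (d + 1) k) T).left.base ⁻¹' {(b : T.left)} := by
      rw [← range_fibreSlice (d + 1) T hU b]
      exact ⟨_, rfl⟩
    exact hmem
  -- lift `z` to the generic fibre of `X ×ₖ Γ^ν → Γ^ν`
  obtain ⟨x, hx⟩ := exists_point_XK_curveB_of_snd_eq T (b : T.left) X hzb
  -- `κ(b) ≅ k(Γ^ν)` and the `k`-structures
  obtain ⟨e, hgen, hek0⟩ := exists_ringEquiv_residueField_curveB T (b : T.left)
    (curveν_genericPoint T (b : T.left))
  letI algkκ : Algebra k (IsLocalRing.ResidueField (T.left.presheaf.stalk (b : T.left))) :=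
    ((algebraMap Γ(T.left, U) (IsLocalRing.ResidueField (T.left.presheaf.stalk (b : T.left)))).comp
      (algebraMap k Γ(T.left, U))).toAlgebra
  haveI : IsScalarTower k Γ(T.left, U) (IsLocalRing.ResidueField (T.left.presheaf.stalk (b : T.left))) :=
    IsScalarTower.of_algebraMap_eq fun _ => rfl
  have hek : ∀ c : k, e (algebraMap k (IsLocalRing.ResidueField (T.left.presheaf.stalk (b : T.left))) c) =
      algebraMap k C.left.functionField c := by
    intro c
    have h1 : algebraMap k (IsLocalRing.ResidueField (T.left.presheaf.stalk (b : T.left))) c =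
        T.left.Γevaluation (b : T.left) (T.hom.appTop ((Scheme.ΓSpecIso (.of k)).inv c)) := by
      change algebraMap Γ(T.left, U) _ (algebraMap k Γ(T.left, U) c) = _
      rw [IsScalarTower.algebraMap_apply Γ(T.left, U) (T.left.presheaf.stalk (b : T.left))]
      change IsLocalRing.residue _ (T.left.presheaf.germ U (b : T.left) b.2
        (SchemeOver.scalarRingHom T U c)) = _
      rw [SchemeOver.scalarRingHom_apply, Scheme.Hom.appLE, CommRingCat.comp_apply,
        TopCat.Presheaf.germ_res_apply]
      rfl
    rw [h1]
    exact hek0 c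
  -- `x` lies over a `k(Γ^ν)`-line point
  have hxline := isLinearSubspacePoint_iK_of_fibre_linePoint (d + 1) T (b : T.left) hU b (by omega)
    X i e hgen hek hLb hLbhom hz hx
  -- Stage 2 over the curve `Γ^ν`
  obtain ⟨s, w, hs, hrat⟩ := exists_planes_of_line C X i hrange hd hB1 hpid htr hF3 x hxline
  refine ⟨s, w, hs, ?_⟩
  rw [← hx, map_fst_primeCycle_eq_of_curveB T (b : T.left) X x]
  exact hrat

end ProjFamily

end Literature.AlgebraicGeometry.Motives

end
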